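import Mathlib
import Summits.Ventures.PercRepro2.PendantB
import Summits.Ventures.PercRepro2.RowCert
import Summits.Ventures.PercRepro2.HalfL

/-!
# Both halves of (HCOV) when `a₃` is a leaf at `b`: a four-block certificate for the `L`-half
(blind cell PercRepro2, night-1 g36; proofs/NIGHT1-G36.md §0′ 9)

With `a₃` a leaf attached to `b` by the edge `f` of weight `q = p f`, the cleared `L`-half
`SharpHalves.GammaLc` is an `a₃`-free cubic in the masses under `Q = {a₁ ↮ a₂}` (the lemmas of
`PendantO` with the attachment vertex `b`, exactly as `PendantB.Gc_pendant_b`), and it is a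
NONNEGATIVE COMBINATION of the four landed blocks of `RowCert.row_nonneg`:

  `ΓLc = 2 [ (1 − q)(P − q bL) · X₄ + q (1 − q) bL · X₃ + q (bH + b₀ + (1 − q) bL) · M₂ + q² bL · M₁ ]`

with `b₀ = P − bL − bH`, `X₄ = oH bL − P C ≥ 0`, `X₃ = oL bH − P Dd ≥ 0` (BHK06 Thm 1.4 cross
cluster, `bhk_cross_cluster_avoid` with the avoided root), `M₂ = bL (oH − B − C) − b₀ C ≥ 0`,
`M₁ = bH (oL − A − Dd) − b₀ Dd ≥ 0` (the same theorem with the avoided set `{other root, b}`);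
`A = P(Q, oL, bL)`, `B = P(Q, oH, bH)`, `C = P(Q, oH, bL)`, `Dd = P(Q, oL, bH)`.

* **`GammaLc_pendant_b`**: the identity (a polynomial identity after the mass rewrites);
* **`HalfL_pendant_b`**, **`HalfH_pendant_b`**: HALF-L and HALF-H at every labelled instance whose
  `a₃` is a leaf at `b`, for every leaf weight — the pendant-at-`b` class is closed for both halves
  (the cell's `RowCert.HCov_pendant_b` for their sum, now TERM BY TERM).

Reading (night-1 g36): at `q = 1` the identity is the two-mark inequality
`(bH + b₀) M₂ + bL M₁ ≥ 0` = HALF-L at the coincidence `a₃ = b`; the indefinite root-asymmetric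
term `q(1 − q) bL [bH P(Q, o∈U, bL) − bL P(Q, o∈U, bH)]` of the naive split
`D(q) Γ = (1 − q) P X₄ + q PB1′ + …` is absorbed exactly by the blocks. Own exact checks
(mining/night-1/g36/): the identity on 60 / 60 random instances `n ≤ 6`, weights `k/10`, `q ∈ {0, …, 1}`.
-/

namespace Summit.Ventures.PercRepro2

open UnionCluster CovForm PendantRoot PendantO PendantB

namespace HalfLPendantB

variable {V : Type*} {E : Type*} [Fintype E] [DecidableEq E] {R : Type*} [Field R]
  [LinearOrder R] [IsStrictOrderedRing R]

section Identity

variable (p : E → R) (ends : E → Sym2 V)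

omit [LinearOrder R] [IsStrictOrderedRing R] in
/-- **The `L`-half at a pendant `a₃` attached to `b`** (cleared, `a₃`-free): with `P = P(Q)`, `q = p f`,
`ΓLc = 2 [(1 − q)(P − q bL) X₄ + q (1 − q) bL X₃ + q (bH + b₀ + (1 − q) bL) M₂ + q² bL M₁]`. -/
theorem GammaLc_pendant_b {f : E} {a₃ b : V} (hf : ends f = s(a₃, b))
    (hleaf : ∀ e, a₃ ∈ ends e → e = f) (h3b : a₃ ≠ b) {o a₁ a₂ : V} (h31 : a₃ ≠ a₁)
    (h32 : a₃ ≠ a₂) (ho : o ≠ a₃) :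
    let Q := avoidAll ends a₂ {a₁}
    let P := prob p Q
    let q := p f
    let bL := prob p (Q ∩ connEvent ends a₁ b)
    let bH := prob p (Q ∩ connEvent ends a₂ b)
    let oL := prob p (Q ∩ connEvent ends a₁ o)
    let oH := prob p (Q ∩ connEvent ends a₂ o)
    let A := prob p (Q ∩ (connEvent ends a₁ o ∩ connEvent ends a₁ b))
    let B := prob p (Q ∩ (connEvent ends a₂ o ∩ connEvent ends a₂ b))
    let C := prob p (Q ∩ (connEvent ends a₂ o ∩ connEvent ends a₁ b))
    let Dd := prob p (Q ∩ (connEvent ends a₁ o ∩ connEvent ends a₂ b))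
    SharpHalves.GammaLc p ends o a₁ a₂ a₃ b =
      2 * ((1 - q) * (P - q * bL) * (oH * bL - P * C) +
        q * (1 - q) * bL * (oL * bH - P * Dd) +
        q * (bH + (P - bL - bH) + (1 - q) * bL) * (bL * (oH - B - C) - (P - bL - bH) * C) +
        q ^ 2 * bL * (bH * (oL - A - Dd) - (P - bL - bH) * Dd)) := by
  intro Q P q bL bH oL oH A B C Dd
  have hb : b ≠ a₃ := Ne.symm h3b
  have c₁o := free_connEvent hf hleaf h3b (Ne.symm h31) ho
  have c₂o := free_connEvent hf hleaf h3b (Ne.symm h32) ho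
  have c₁b := free_connEvent hf hleaf h3b (Ne.symm h31) hb
  simp only [Q, P, q, bL, bH, oL, oH, A, B, C, Dd]
  unfold SharpHalves.GammaLc DEF EQo EQ3 EQ3o Do
  simp only [prob_PD_o p hf hleaf h3b h31 h32, prob_T_o p hf hleaf h3b h31 h32,
    prob_T'_o p hf hleaf h3b h31 h32,
    prob_PD_inter_o p hf hleaf h3b h31 h32 c₁b,
    prob_PD_inter_o p hf hleaf h3b h31 h32 c₁o, prob_PD_inter_o p hf hleaf h3b h31 h32 c₂o,
    prob_PD_inter_o p hf hleaf h3b h31 h32 (c₁o.inter c₁b),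
    prob_PD_inter_o p hf hleaf h3b h31 h32 (c₂o.inter c₁b),
    prob_T_inter_o p hf hleaf h3b h31 h32 c₁b,
    prob_T_inter_o p hf hleaf h3b h31 h32 c₁o, prob_T_inter_o p hf hleaf h3b h31 h32 c₂o,
    prob_T_inter_o p hf hleaf h3b h31 h32 (c₁o.inter c₁b),
    prob_T_inter_o p hf hleaf h3b h31 h32 (c₂o.inter c₁b),
    prob_T'_inter_o p hf hleaf h3b h31 h32 c₁b,
    prob_T'_inter_o p hf hleaf h3b h31 h32 c₁o, prob_T'_inter_o p hf hleaf h3b h31 h32 c₂o,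
    prob_T'_inter_o p hf hleaf h3b h31 h32 (c₁o.inter c₁b),
    prob_T'_inter_o p hf hleaf h3b h31 h32 (c₂o.inter c₁b),
    Q_inter_absorb, Q_inter_both_eq_empty₂', Q_inter_both_last',
    prob_empty, Set.inter_self,
    Q_inter_swap (avoidAll ends a₂ {a₁}) (connEvent ends a₁ b) (connEvent ends a₁ o),
    Q_inter_swap (avoidAll ends a₂ {a₁}) (connEvent ends a₁ b) (connEvent ends a₂ o),
    Q_inter_swap (avoidAll ends a₂ {a₁}) (connEvent ends a₂ b) (connEvent ends a₁ o),
    Q_inter_swap (avoidAll ends a₂ {a₁}) (connEvent ends a₂ b) (connEvent ends a₂ o)]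
  ring

end Identity

section Theorem

variable [Fintype V] [DecidableEq V] (p : E → R) (ends : E → Sym2 V)

/-- **HALF-L at every pendant `a₃` attached to `b`**, for every leaf weight: the four blocks
`X₃, X₄, M₁, M₂ ≥ 0` (BHK06 Thm 1.4 in the two forms of `RowCert`) with nonnegative brackets. -/
theorem HalfL_pendant_b (hp : IsProbVec p) {f : E} {a₃ b : V} (hf : ends f = s(a₃, b))
    (hleaf : ∀ e, a₃ ∈ ends e → e = f) (h3b : a₃ ≠ b) {o a₁ a₂ : V} (h31 : a₃ ≠ a₁)
    (h32 : a₃ ≠ a₂) (ho : o ≠ a₃) : SharpHalves.HalfL p ends o a₁ a₂ a₃ b := by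
  unfold SharpHalves.HalfL
  rw [GammaLc_pendant_b p ends hf hleaf h3b h31 h32 ho]
  -- names
  set Q := avoidAll ends a₂ {a₁} with dQ
  set P := prob p Q with dP
  set q := p f with dq
  set bL := prob p (Q ∩ connEvent ends a₁ b) with dbL
  set bH := prob p (Q ∩ connEvent ends a₂ b) with dbH
  set oL := prob p (Q ∩ connEvent ends a₁ o) with doL
  set oH := prob p (Q ∩ connEvent ends a₂ o) with doH
  set A := prob p (Q ∩ (connEvent ends a₁ o ∩ connEvent ends a₁ b)) with dA
  set B := prob p (Q ∩ (connEvent ends a₂ o ∩ connEvent ends a₂ b)) with dB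
  set C := prob p (Q ∩ (connEvent ends a₂ o ∩ connEvent ends a₁ b)) with dC
  set Dd := prob p (Q ∩ (connEvent ends a₁ o ∩ connEvent ends a₂ b)) with dDd
  -- membership facts under `Q`
  have hQ : ∀ ω ∈ Q, ¬ Conn ends ω a₂ a₁ := fun _ h => h a₁ (Finset.mem_singleton_self a₁)
  -- `b₀ ≥ 0`
  have hsplit := RowCert.prob_split_b p ends a₁ a₂ b Q hQ
  have hb0 : 0 ≤ P - bL - bH := by
    have := prob_nonneg hp (Q ∩ (connEvent ends a₁ b)ᶜ ∩ (connEvent ends a₂ b)ᶜ)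
    linarith only [hsplit, this]
  -- the avoidance events of the two sources
  have eQ1 : avoidAll ends a₁ {a₂} = Q := by rw [dQ, RowCert.avoidAll_swap]
  have eR2 : avoidAll ends a₂ {a₁, b} = Q ∩ (connEvent ends a₂ b)ᶜ := by
    rw [← RowCert.avoidAll_pair, RowCert.avoidAll_singleton_eq ends a₂ b, dQ]
  have eR1 : avoidAll ends a₁ {a₂, b} = Q ∩ (connEvent ends a₁ b)ᶜ := by
    rw [← RowCert.avoidAll_pair, RowCert.avoidAll_singleton_eq ends a₁ b,
      RowCert.avoidAll_swap ends a₁ a₂, dQ]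
  -- `bL ⊆ bHᶜ` and `bH ⊆ bLᶜ` under `Q`
  have sL : Q ∩ connEvent ends a₁ b ∩ (connEvent ends a₂ b)ᶜ = Q ∩ connEvent ends a₁ b := by
    ext ω
    simp only [Set.mem_inter_iff, Set.mem_compl_iff, mem_connEvent]
    exact ⟨fun h => h.1, fun h => ⟨h, fun h2 => hQ ω h.1 (conn_trans h2 (conn_symm h.2))⟩⟩
  have sH : Q ∩ connEvent ends a₂ b ∩ (connEvent ends a₁ b)ᶜ = Q ∩ connEvent ends a₂ b := by
    ext ω
    simp only [Set.mem_inter_iff, Set.mem_compl_iff, mem_connEvent]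
    exact ⟨fun h => h.1, fun h => ⟨h, fun h1 => hQ ω h.1 (conn_trans h.2 (conn_symm h1))⟩⟩
  -- (M₂): `C (P − bH) ≤ (oH − B) bL`
  have hM2 : C * (P - bH) ≤ (oH - B) * bL := by
    have key := bhk_cross_cluster_avoid p hp ends a₂ a₁ (X := {a₁, b}) (by simp)
      (RowCert.isUpperSet_mem o) (RowCert.isUpperSet_mem b)
    rw [RowCert.clusterInEvent_mem_eq, RowCert.clusterInEvent_mem_eq, eR2] at key
    have e1 : prob p (Q ∩ (connEvent ends a₂ b)ᶜ) = P - bH := by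
      have := prob_inter_add_prob_inter_compl p Q (connEvent ends a₂ b)
      linarith only [this]
    have e2 : connEvent ends a₂ o ∩ connEvent ends a₁ b ∩ (Q ∩ (connEvent ends a₂ b)ᶜ) =
        Q ∩ (connEvent ends a₂ o ∩ connEvent ends a₁ b) := by
      ext ω
      simp only [Set.mem_inter_iff, Set.mem_compl_iff, mem_connEvent]
      constructor
      · rintro ⟨⟨ho', hb⟩, hq, _⟩; exact ⟨hq, ho', hb⟩
      · rintro ⟨hq, ho', hb⟩; exact ⟨⟨ho', hb⟩, hq, fun h2 => hQ ω hq (conn_trans h2 (conn_symm hb))⟩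
    have e3 : prob p (connEvent ends a₂ o ∩ (Q ∩ (connEvent ends a₂ b)ᶜ)) = oH - B := by
      have h := prob_inter_add_prob_inter_compl p (Q ∩ connEvent ends a₂ o) (connEvent ends a₂ b)
      have e : connEvent ends a₂ o ∩ (Q ∩ (connEvent ends a₂ b)ᶜ) =
          Q ∩ connEvent ends a₂ o ∩ (connEvent ends a₂ b)ᶜ := by
        ext ω; simp only [Set.mem_inter_iff]; tauto
      have e' : Q ∩ connEvent ends a₂ o ∩ connEvent ends a₂ b =
          Q ∩ (connEvent ends a₂ o ∩ connEvent ends a₂ b) := Set.inter_assoc _ _ _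
      rw [e'] at h; rw [e]; linarith only [h]
    have e4 : prob p (connEvent ends a₁ b ∩ (Q ∩ (connEvent ends a₂ b)ᶜ)) = bL := by
      have e : connEvent ends a₁ b ∩ (Q ∩ (connEvent ends a₂ b)ᶜ) =
          Q ∩ connEvent ends a₁ b ∩ (connEvent ends a₂ b)ᶜ := by
        ext ω; simp only [Set.mem_inter_iff]; tauto
      rw [e, sL]
    rw [e1, e2, e3, e4] at key
    exact key
  -- (M₁): `Dd (P − bL) ≤ (oL − A) bH`
  have hM1 : Dd * (P - bL) ≤ (oL - A) * bH := by
    have key := bhk_cross_cluster_avoid p hp ends a₁ a₂ (X := {a₂, b}) (by simp)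
      (RowCert.isUpperSet_mem o) (RowCert.isUpperSet_mem b)
    rw [RowCert.clusterInEvent_mem_eq, RowCert.clusterInEvent_mem_eq, eR1] at key
    have e1 : prob p (Q ∩ (connEvent ends a₁ b)ᶜ) = P - bL := by
      have := prob_inter_add_prob_inter_compl p Q (connEvent ends a₁ b)
      linarith only [this]
    have e2 : connEvent ends a₁ o ∩ connEvent ends a₂ b ∩ (Q ∩ (connEvent ends a₁ b)ᶜ) =
        Q ∩ (connEvent ends a₁ o ∩ connEvent ends a₂ b) := by
      ext ω
      simp only [Set.mem_inter_iff, Set.mem_compl_iff, mem_connEvent]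
      constructor
      · rintro ⟨⟨ho', hb⟩, hq, _⟩; exact ⟨hq, ho', hb⟩
      · rintro ⟨hq, ho', hb⟩; exact ⟨⟨ho', hb⟩, hq, fun h1 => hQ ω hq (conn_trans hb (conn_symm h1))⟩
    have e3 : prob p (connEvent ends a₁ o ∩ (Q ∩ (connEvent ends a₁ b)ᶜ)) = oL - A := by
      have h := prob_inter_add_prob_inter_compl p (Q ∩ connEvent ends a₁ o) (connEvent ends a₁ b)
      have e : connEvent ends a₁ o ∩ (Q ∩ (connEvent ends a₁ b)ᶜ) =
          Q ∩ connEvent ends a₁ o ∩ (connEvent ends a₁ b)ᶜ := by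
        ext ω; simp only [Set.mem_inter_iff]; tauto
      have e' : Q ∩ connEvent ends a₁ o ∩ connEvent ends a₁ b =
          Q ∩ (connEvent ends a₁ o ∩ connEvent ends a₁ b) := Set.inter_assoc _ _ _
      rw [e'] at h; rw [e]; linarith only [h]
    have e4 : prob p (connEvent ends a₂ b ∩ (Q ∩ (connEvent ends a₁ b)ᶜ)) = bH := by
      have e : connEvent ends a₂ b ∩ (Q ∩ (connEvent ends a₁ b)ᶜ) =
          Q ∩ connEvent ends a₂ b ∩ (connEvent ends a₁ b)ᶜ := by
        ext ω; simp only [Set.mem_inter_iff]; tauto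
      rw [e, sH]
    rw [e1, e2, e3, e4] at key
    exact key
  -- (X₃): `P Dd ≤ oL bH` (cross cluster, avoid `a₂`)
  have hX3 : P * Dd ≤ oL * bH := by
    have key := bhk_cross_cluster_avoid p hp ends a₁ a₂ (X := {a₂}) (by simp)
      (RowCert.isUpperSet_mem o) (RowCert.isUpperSet_mem b)
    rw [RowCert.clusterInEvent_mem_eq, RowCert.clusterInEvent_mem_eq, eQ1] at key
    have e1 : connEvent ends a₁ o ∩ connEvent ends a₂ b ∩ Q =
        Q ∩ (connEvent ends a₁ o ∩ connEvent ends a₂ b) := Set.inter_comm _ _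
    have e2 : connEvent ends a₁ o ∩ Q = Q ∩ connEvent ends a₁ o := Set.inter_comm _ _
    have e3 : connEvent ends a₂ b ∩ Q = Q ∩ connEvent ends a₂ b := Set.inter_comm _ _
    rw [e1, e2, e3] at key
    linarith only [key]
  -- (X₄): `P C ≤ oH bL` (cross cluster, avoid `a₁`)
  have hX4 : P * C ≤ oH * bL := by
    have key := bhk_cross_cluster_avoid p hp ends a₂ a₁ (X := {a₁}) (by simp)
      (RowCert.isUpperSet_mem o) (RowCert.isUpperSet_mem b)
    rw [RowCert.clusterInEvent_mem_eq, RowCert.clusterInEvent_mem_eq] at key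
    have e1 : connEvent ends a₂ o ∩ connEvent ends a₁ b ∩ avoidAll ends a₂ {a₁} =
        Q ∩ (connEvent ends a₂ o ∩ connEvent ends a₁ b) := Set.inter_comm _ _
    have e2 : connEvent ends a₂ o ∩ avoidAll ends a₂ {a₁} = Q ∩ connEvent ends a₂ o :=
      Set.inter_comm _ _
    have e3 : connEvent ends a₁ b ∩ avoidAll ends a₂ {a₁} = Q ∩ connEvent ends a₁ b :=
      Set.inter_comm _ _
    rw [e1, e2, e3] at key
    linarith only [key]
  -- the certificate
  have hq0 : 0 ≤ q := hp.nonneg f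
  have hq1 : 0 ≤ 1 - q := by linarith only [hp.le_one f]
  have hbL : 0 ≤ bL := prob_nonneg hp _
  have hbH : 0 ≤ bH := prob_nonneg hp _
  have hPq : 0 ≤ P - q * bL := by
    have hle : bL ≤ P := prob_mono hp Set.inter_subset_left
    nlinarith [hq0, hbL, hle, hp.le_one f]
  have hM2' : 0 ≤ bL * (oH - B - C) - (P - bL - bH) * C := by linarith only [hM2]
  have hM1' : 0 ≤ bH * (oL - A - Dd) - (P - bL - bH) * Dd := by linarith only [hM1]
  have hX4' : 0 ≤ oH * bL - P * C := by linarith only [hX4]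
  have hX3' : 0 ≤ oL * bH - P * Dd := by linarith only [hX3]
  have hbr : 0 ≤ bH + (P - bL - bH) + (1 - q) * bL := by
    have := mul_nonneg hq1 hbL
    linarith only [hbH, hb0, this]
  have t1 := mul_nonneg (mul_nonneg hq1 hPq) hX4'
  have t2 := mul_nonneg (mul_nonneg (mul_nonneg hq0 hq1) hbL) hX3'
  have t3 := mul_nonneg (mul_nonneg hq0 hbr) hM2'
  have t4 := mul_nonneg (mul_nonneg (pow_nonneg hq0 2) hbL) hM1'
  linarith only [t1, t2, t3, t4]

/-- **HALF-H at every pendant `a₃` attached to `b`** (the root swap). -/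
theorem HalfH_pendant_b (hp : IsProbVec p) {f : E} {a₃ b : V} (hf : ends f = s(a₃, b))
    (hleaf : ∀ e, a₃ ∈ ends e → e = f) (h3b : a₃ ≠ b) {o a₁ a₂ : V} (h31 : a₃ ≠ a₁)
    (h32 : a₃ ≠ a₂) (ho : o ≠ a₃) : SharpHalves.HalfH p ends o a₁ a₂ a₃ b :=
  HalfL_pendant_b p ends hp hf hleaf h3b h32 h31 ho

end Theorem

end HalfLPendantB

end Summit.Ventures.PercRepro2
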